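import Mathlib.Topology.Algebra.Group.Basic
import Mathlib.Topology.Algebra.Group.Quotient
import Mathlib.Topology.Algebra.OpenSubgroup
import Mathlib.GroupTheory.Index
import Literature.AnabelianGeometry.SemiGraphs.ArithMaximalCompact
import Literature.AnabelianGeometry.SemiGraphs.ArithmeticCoverings
import HarnessLib

/-!
# [SemiAnbd] Ex 5.6: «it follows immediately from Lemma 5.5 that `𝔊_i`, `𝔊_i^c` are totally
# arithmetically estranged» — the REDUCTION of Def 5.3 (ii) (cross clause) to Lemma 5.5, typed on abstract data

Mochizuki, *Semi-graphs of anabelioids*, Publ. RIMS **42** (2006) 221–322: Def 5.3 (i)/(ii) p. 293 (PRIMS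
pagination; author's manuscript p. 65), Lemma 5.5 p. 294, Example 5.6 p. 295 l. 20–21 («Also, it follows
immediately from Lemma 5.5 that `𝔊_i`, `𝔊_i^c` are totally arithmetically estranged»)
[cite: MochizukiSemiAnbd2006, Ex 5.6, p. 67].

PROOF-ONLY file (cell abc-iut, layer L3, D-0079 L-F pack B [SemiAnbd] §5; seat abc-iut-w4-d059 gen 5, row
«EX56-hest⇐LEM55» = the consumer edge L55-use1 of `plan/L3/SUBDAG-SemiAnbd-Lem55.md`, reduction design of
abc-iut-w6-d064 14:29Z).  No definition, no new named fact: Lemma 5.5 enters ONLY through abc-iut-L3-t3's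
`DecompositionGroupsDetermineStatement` (FACT-LIST F-1367), consumed BY NAME as a hypothesis; Def 5.3 is
abc-iut-L3-t3's `IsArithAmple` / `IsArithEstrangedEdge` / `IsTotallyArithEstranged` on an abstract
`DecompositionData`.

WHAT IS TYPED.  In Ex 5.6 the arithmetic semi-graph `𝔊_i` of the special fibre of a pointed stable curve over a
`p`-adic field has, at each vertex `v` (an irreducible component), the arithmetic decomposition group
`Π_{𝔊,v} ↠ Π_A = G_K`, and the branches `b` at `v` are cusps `x_b` of the component; reducing to the special
fibre and compactifying the component gives a proper curve `X̄_v` over the (finite) residue field `k` with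
`Π_{𝔊,v} → Π_{X̄_v} ↠ G_k`, under which `Π_{𝔊,b}` maps into the decomposition group `σ_{x_b}(G_k)` of the
`k`-point `x_b`.  We type exactly this shape on ABSTRACT data — a «reduction datum» at the vertex `v` of a
`DecompositionData D`:
* `red : Π_{𝔊,v} →* PX` and a continuous `augX : PX →* Gk` with `augX ∘ red = augk` on `Π_{𝔊,v}`;
* points `pt b : Pts` of the branches at `v`, pairwise distinct, with continuous sections `σ x : Gk →* PX` of
  `augX` and `red(Π_{𝔊,b}) ≤ range (σ (pt b))`;
* `Gk` a compact group with a dense cyclic subgroup `⟨F⟩` (Frobenius), `PX` Hausdorff;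
* Lemma 5.5 for `X̄_v` over EVERY finite extension `k'` of `k`: `DecompositionGroupsDetermineStatement` for the
  data restricted to each OPEN subgroup `H = G_{k'} ≤ Gk` (BY NAME; a hypothesis, never discharged here).

WHAT IS PROVED (the «immediately»).  `not_isArithAmple_inf_conj_of_lem55`: for distinct branches `b ≠ b'` at `v`
and every `g ∈ Π_{𝔊,v}`, `Π_{𝔊,b} ∩ g·Π_{𝔊,b'}·g⁻¹` is NOT arithmetically ample for `augk : Gtp →* Gk` — if its
image were open it would contain some `F^m` (`m ≥ 1`: an open subgroup of a compact group has finite index), i.e.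
an element `h` with `red h = σ_x(F^m) = red(g)·σ_y(t')·red(g)⁻¹`; rewriting `red g = c·σ_y(γ)` with
`γ = augk g` exhibits a GEOMETRIC `c` (`augX c = 1`) with `σ_x(F^m) = c·σ_y(F^m)·c⁻¹`; two continuous sections
agreeing at `F^m` agree on `H_m := closure ⟨F^m⟩` (Hausdorff target), which is OPEN (`= G_{k_m}`, the extension
of degree `≤ m`: `isOpen_topologicalClosure_zpowers_pow_of_dense`), so `σ_x|_{k_m}` and `σ_y|_{k_m}` are
`Π`-conjugate by an element over `H_m`, and Lemma 5.5 over `k_m` gives `x_b = x_{b'}`, hence `b = b'` —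
contradiction.  Then:
the transfer `IsArithAmple.comp_of_isOpenMap` along an OPEN continuous `θ : Π_A → Gk` (`G_K ↠ G_k`), the
`Π_A`-form `not_isArithAmple_inf_conj_of_lem55_of_isOpenMap`, and the assemblies `isArithEstrangedEdge_of_cross_of_self`
/ `isTotallyArithEstranged_of_cross_of_self` in which the SELF clause of Def 5.3 (ii) (`b' = b`, `g ∉ Π_{𝔊,b}`)
stays the separate named binder it is in print (p. 293 top: `Π_{𝔊,b}` «may be thought of as the commensurator
in `Π_{𝔊,v}` of `Π_{𝒢,b}`» — not a consequence of Lemma 5.5).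

HONEST RESIDUAL.  Nothing here constructs the data of Ex 5.6 (André's `π₁^temp`, stable reduction, the
reduction maps — FOUNDATIONS rows 12–14 of the cell) or asserts Lemma 5.5; the reduction datum and
`DecompositionGroupsDetermineStatement` over the `k_m` are HYPOTHESES; the conclusion is OUR kernel theorem on
abstract data.  typed ≠ proved for the inputs; nothing here bears on [IUTchIII] Cor. 3.12; no side taken.
-/

namespace Literature.AnabelianGeometry.SemiGraphs

open Topology

universe u u' u'' w w'

variable {Gtp : Type u} [Group Gtp]
variable {PA : Type u'} [Group PA] [TopologicalSpace PA]
variable {Gk : Type u''} [Group Gk] [TopologicalSpace Gk]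
variable {V : Type w} {B : Type w'}

/-! ### §1. Transfer of arithmetic ampleness along an open homomorphism `Π_A → G_k` -/

/-- Arithmetic ampleness (Def 5.3 (i): open image in `Π_A`) is transported along an OPEN homomorphism
`θ : Π_A → G_k` (e.g. the residue map `G_K ↠ G_k` of a `p`-adic field): the image in `G_k` is the `θ`-image
of the image in `Π_A`. [cite: MochizukiSemiAnbd2006, Def 5.3 (i), p. 65] -/
theorem IsArithAmple.comp_of_isOpenMap {aug : Gtp →* PA} {θ : PA →* Gk} (hθ : IsOpenMap θ)
    {K : Subgroup Gtp} (hK : IsArithAmple aug K) : IsArithAmple (θ.comp aug) K := by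
  unfold IsArithAmple at hK ⊢
  rw [← Subgroup.map_map, Subgroup.coe_map]
  exact hθ _ hK

/-- Contrapositive transfer: a subgroup that is not arithmetically ample for `θ ∘ aug : Π → G_k` is not
arithmetically ample for `aug : Π → Π_A`, `θ` open. [cite: MochizukiSemiAnbd2006, Def 5.3 (i), p. 65] -/
theorem not_isArithAmple_of_not_isArithAmple_comp {aug : Gtp →* PA} {θ : PA →* Gk} (hθ : IsOpenMap θ)
    {K : Subgroup Gtp} (hK : ¬ IsArithAmple (θ.comp aug) K) : ¬ IsArithAmple aug K :=
  fun h => hK (h.comp_of_isOpenMap hθ)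

/-! ### §2. Two lemmas of topological group theory -/

/-- An open subgroup of a compact group contains a positive power of any element (the quotient is compact
and discrete, hence finite; pigeonhole on the cosets `F^i · S`).  In Ex 5.6: an open subgroup of `G_k`
contains a power of Frobenius. [cite: MochizukiSemiAnbd2006, Ex 5.6, p. 67] -/
theorem exists_pow_mem_of_isOpen_of_compactSpace [IsTopologicalGroup Gk] [CompactSpace Gk]
    (S : Subgroup Gk) (hS : IsOpen (S : Set Gk)) (F : Gk) : ∃ m : ℕ, 0 < m ∧ F ^ m ∈ S := by
  haveI : DiscreteTopology (Gk ⧸ S) := QuotientGroup.discreteTopology_iff.mpr hS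
  haveI : Finite (Gk ⧸ S) := finite_of_compact_of_discrete
  haveI : S.FiniteIndex := Subgroup.finiteIndex_of_finite_quotient
  obtain ⟨n, hn, -, hmem⟩ := S.exists_pow_mem_of_index_ne_zero S.index_ne_zero_of_finite F
  exact ⟨n, hn, hmem⟩

/-- Two continuous homomorphisms into a Hausdorff group that agree at `t` agree on the closed subgroup
topologically generated by `t`.  In Ex 5.6: a section over `k` is determined on `G_{k_m} = closure ⟨F^m⟩` by
its value at `F^m`. [cite: MochizukiSemiAnbd2006, Ex 5.6, p. 67] -/
theorem eqOn_topologicalClosure_zpowers_of_apply_eq {PX : Type*} [Group PX] [TopologicalSpace PX]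
    [T2Space PX] [IsTopologicalGroup Gk] {f g : Gk →* PX} (hf : Continuous f) (hg : Continuous g) {t : Gk}
    (h : f t = g t) :
    Set.EqOn f g ((Subgroup.zpowers t).topologicalClosure : Set Gk) := by
  rw [Subgroup.topologicalClosure_coe]
  refine Set.EqOn.closure ?_ hf hg
  rintro s ⟨k, rfl⟩
  simp only [map_zpow, h]

/-- If `⟨F⟩` is dense in the topological group `G_k` (Frobenius topologically generates `G_k`), then for
`m ≥ 1` the closed subgroup `closure ⟨F^m⟩` has index at most `m` (the closed cosets `F^i · closure ⟨F^m⟩`,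
`i < m`, cover the dense set `⟨F⟩`, hence everything), so it is OPEN: it is the absolute Galois group
`G_{k_m}` of the FINITE extension of degree `≤ m` — the base over which Ex 5.6 invokes Lemma 5.5.
[cite: MochizukiSemiAnbd2006, Ex 5.6, p. 67] -/
theorem isOpen_topologicalClosure_zpowers_pow_of_dense [IsTopologicalGroup Gk] {F : Gk}
    (hF : Dense ((Subgroup.zpowers F : Subgroup Gk) : Set Gk)) {m : ℕ} (hm : 0 < m) :
    IsOpen (((Subgroup.zpowers (F ^ m)).topologicalClosure : Subgroup Gk) : Set Gk) := by
  set H : Subgroup Gk := (Subgroup.zpowers (F ^ m)).topologicalClosure with hH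
  have hHc : IsClosed (H : Set Gk) := Subgroup.isClosed_topologicalClosure _
  -- the finite union of the closed cosets `F^i · H`, `i < m`
  set C : Set Gk := ⋃ i ∈ Finset.range m, (fun h : Gk => F ^ i * h) '' (H : Set Gk) with hCdef
  have hC : IsClosed C := by
    refine isClosed_biUnion_finset fun i _ => ?_
    exact (Homeomorph.mulLeft (F ^ i)).isClosedMap _ hHc
  -- it contains `⟨F⟩`: `F^k = F^r · (F^m)^q` with `k = r + m q`, `0 ≤ r < m`
  have hsub : ((Subgroup.zpowers F : Subgroup Gk) : Set Gk) ⊆ C := by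
    rintro _ ⟨k, rfl⟩
    have hm0 : (0 : ℤ) < m := by exact_mod_cast hm
    have hr0 : 0 ≤ k % (m : ℤ) := Int.emod_nonneg _ hm0.ne'
    have hrm : k % (m : ℤ) < m := Int.emod_lt_of_pos _ hm0
    have hk : k % (m : ℤ) + (m : ℤ) * (k / (m : ℤ)) = k := Int.emod_add_mul_ediv k m
    refine Set.mem_iUnion₂.mpr ⟨(k % (m : ℤ)).toNat, Finset.mem_range.mpr (by omega), (F ^ m) ^ (k / (m : ℤ)),
      Subgroup.le_topologicalClosure _ (Subgroup.mem_zpowers_iff.mpr ⟨k / (m : ℤ), rfl⟩), ?_⟩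
    show F ^ (k % (m : ℤ)).toNat * (F ^ m) ^ (k / (m : ℤ)) = F ^ k
    rw [← zpow_natCast F (k % (m : ℤ)).toNat, Int.toNat_of_nonneg hr0, ← zpow_natCast F m, ← zpow_mul,
      ← zpow_add, hk]
  have hCuniv : C = Set.univ :=
    Set.eq_univ_of_univ_subset (hF.closure_eq ▸ closure_minimal hsub hC)
  -- hence every `g` lies in some coset `F^i · H`, `i < m`
  have hcov : ∀ g : Gk, ∃ i : ℕ, i < m ∧ (F ^ i)⁻¹ * g ∈ H := by
    intro g
    have hg : g ∈ C := hCuniv ▸ Set.mem_univ g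
    obtain ⟨i, hi, h, hh, rfl⟩ := Set.mem_iUnion₂.mp hg
    exact ⟨i, Finset.mem_range.mp hi, by simpa using hh⟩
  -- so `H` has finite index, and a closed subgroup of finite index is open
  haveI : Finite (Gk ⧸ H) := by
    refine Finite.of_surjective (fun i : Fin m => (QuotientGroup.mk (F ^ (i : ℕ)) : Gk ⧸ H)) ?_
    intro q
    obtain ⟨g, rfl⟩ := QuotientGroup.mk_surjective q
    obtain ⟨i, hi, hmem⟩ := hcov g
    exact ⟨⟨i, hi⟩, QuotientGroup.eq.mpr hmem⟩
  haveI : H.FiniteIndex := Subgroup.finiteIndex_of_finite_quotient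
  exact Subgroup.isOpen_of_isClosed_of_finiteIndex H hHc

/-! ### §3. The cross clause of Def 5.3 (ii) from Lemma 5.5 -/

section Reduction

variable {PX : Type*} [Group PX] [TopologicalSpace PX]
variable {Pts : Type*}

/-- **Ex 5.6 «immediately from Lemma 5.5» — the cross clause of Def 5.3 (ii) at a vertex carrying a
reduction datum.**  Data: an abstract `DecompositionData D` with augmentation `augk : Π → G_k`, `G_k` compact
with a dense cyclic subgroup `⟨F⟩`; at the vertex `v` a reduction `red : Π_{𝔊,v} → Π_X` over `G_k`
(`augX ∘ red = augk`), `Π_X` Hausdorff, continuous sections `σ x` of `augX` at points `x : Pts`, the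
branches `b` at `v` carrying pairwise distinct points `pt b` with `red(Π_{𝔊,b}) ≤ range σ_{pt b}`; and
Lemma 5.5 (`DecompositionGroupsDetermineStatement`, F-1367) for the data restricted to every open
subgroup `H = G_{k'}` of `G_k` («over every finite extension `k'`»).  Conclusion: for branches `b ≠ b'` at `v` and
`g ∈ Π_{𝔊,v}`, `Π_{𝔊,b} ∩ g·Π_{𝔊,b'}·g⁻¹` is not arithmetically ample.
[cite: MochizukiSemiAnbd2006, Ex 5.6, p. 67] -/
theorem not_isArithAmple_inf_conj_of_lem55 [IsTopologicalGroup Gk] [CompactSpace Gk]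
    [IsTopologicalGroup PX] [T2Space PX]
    (D : DecompositionData Gtp V B) (augk : Gtp →* Gk) (v : V)
    -- the reduction datum at `v`
    (red : D.vertGp v →* PX) (augX : PX →* Gk)
    (hcomp : ∀ g : D.vertGp v, augX (red g) = augk g)
    (σ : Pts → (Gk →* PX)) (hσ : ∀ x, augX.comp (σ x) = MonoidHom.id Gk) (hσc : ∀ x, Continuous (σ x))
    (pt : B → Pts)
    (hpt : ∀ (b : B) (hb : D.abut b = some v) (h : Gtp) (hh : h ∈ D.brGp b),
      red ⟨h, D.brGp_le_vertGp b v hb hh⟩ ∈ (σ (pt b)).range)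
    (hinj : ∀ b b' : B, D.abut b = some v → D.abut b' = some v → pt b = pt b' → b = b')
    -- Frobenius
    (F : Gk) (hF : Dense ((Subgroup.zpowers F : Subgroup Gk) : Set Gk))
    -- Lemma 5.5 over every finite extension `k'` of `k`, i.e. for the data restricted to every OPEN
    -- subgroup `H = G_{k'}` of `G_k` (BY NAME, F-1367)
    (h55 : ∀ H : Subgroup Gk, IsOpen (H : Set Gk) →
      ∀ hx : ∀ (x : Pts) (s : H), σ x s ∈ H.comap augX,
        DecompositionGroupsDetermineStatement (augX.subgroupComap H)
          (fun x => ((σ x).comp H.subtype).codRestrict (H.comap augX) (fun s => hx x s)))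
    -- conclusion: the cross clause of Def 5.3 (ii) at `v`
    {b b' : B} (hb : D.abut b = some v) (hb' : D.abut b' = some v) (hne : b' ≠ b)
    {g : Gtp} (hg : g ∈ D.vertGp v) :
    ¬ IsArithAmple augk (D.brGp b ⊓ conjSubgroup g (D.brGp b')) := by
  classical
  intro hample
  -- sections are sections (pointwise)
  have hσ' : ∀ x s, augX (σ x s) = s := fun x s => by
    simpa using DFunLike.congr_fun (hσ x) s
  -- Step 1: an open subgroup of the compact `G_k` contains a positive power `F^m` of Frobenius
  obtain ⟨m, hm, hFm⟩ := exists_pow_mem_of_isOpen_of_compactSpace _ hample F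
  -- so some `h ∈ Π_b ∩ g Π_{b'} g⁻¹` lies over `t := F^m`
  obtain ⟨h, hh, hht⟩ := Subgroup.mem_map.mp hFm
  obtain ⟨hhb, hhconj⟩ := Subgroup.mem_inf.mp hh
  obtain ⟨h', hh', hconj⟩ := Subgroup.mem_map.mp hhconj
  simp only [MulEquiv.coe_toMonoidHom, MulAut.conj_apply] at hconj
  -- elements of `Π_{𝔊,v}` as terms of the subtype
  have hhv : h ∈ D.vertGp v := D.brGp_le_vertGp b v hb hhb
  have hh'v : h' ∈ D.vertGp v := D.brGp_le_vertGp b' v hb' hh'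
  set gv : D.vertGp v := ⟨g, hg⟩ with hgv
  set hv : D.vertGp v := ⟨h, hhv⟩ with hhv_def
  set h'v : D.vertGp v := ⟨h', hh'v⟩ with hh'v_def
  have hmul : hv = gv * h'v * gv⁻¹ := by
    apply Subtype.ext
    simp [hgv, hhv_def, hh'v_def, hconj]
  -- Step 2: `red h = σ_x (F^m)` and `red h' = σ_y t'`
  set x : Pts := pt b with hx_def
  set y : Pts := pt b' with hy_def
  obtain ⟨t₁, ht₁⟩ := hpt b hb h hhb
  obtain ⟨t₂, ht₂⟩ := hpt b' hb' h' hh'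
  have ht₁' : t₁ = F ^ m := by
    have := congrArg augX ht₁
    rw [hσ', hcomp] at this
    rw [this]; exact hht
  have hredh : red hv = σ x (F ^ m) := by rw [← ht₁']; exact ht₁.symm
  have hredh' : red h'v = σ y t₂ := ht₂.symm
  -- `t₂ = γ⁻¹ (F^m) γ` with `γ := augk g = augX (red g)`
  set γ : Gk := augX (red gv) with hγ
  have ht₂' : t₂ = γ⁻¹ * F ^ m * γ := by
    have e1 : augX (red hv) = F ^ m := by rw [hredh, hσ']
    have e2 : augX (red h'v) = t₂ := by rw [hredh', hσ']
    rw [hmul, map_mul, map_mul, map_inv, map_mul, map_mul, map_inv, e2] at e1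
    rw [← e1, hγ]; group
  -- Step 3: the GEOMETRIC conjugator `c := red g · σ_y(γ)⁻¹`
  set c : PX := red gv * (σ y γ)⁻¹ with hc
  have hcgeom : augX c = 1 := by rw [hc, map_mul, map_inv, hσ', ← hγ, mul_inv_cancel]
  have hcσ : ∀ s, c * σ y s * c⁻¹ = red gv * σ y (γ⁻¹ * s * γ) * (red gv)⁻¹ := fun s => by
    rw [hc]; simp only [map_mul, map_inv, mul_inv_rev, inv_inv]; group
  -- `σ_x` and `Inn(c) ∘ σ_y` agree at `F^m`
  have hagree : σ x (F ^ m) = c * σ y (F ^ m) * c⁻¹ := by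
    rw [hcσ, ← ht₂', ← hredh', ← hredh, hmul, map_mul, map_mul, map_inv]
  -- Step 4: hence they agree on `H_m := closure ⟨F^m⟩` (continuity, Hausdorff target)
  set H : Subgroup Gk := (Subgroup.zpowers (F ^ m)).topologicalClosure with hH
  let τ : Gk →* PX := (MulAut.conj c).toMonoidHom.comp (σ y)
  have hτ : ∀ s, τ s = c * σ y s * c⁻¹ := fun s => by simp [τ, MulAut.conj_apply]
  have hτc' : Continuous (τ : Gk → PX) := by
    have : (τ : Gk → PX) = fun s => c * σ y s * c⁻¹ := funext hτ
    rw [this]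
    exact (continuous_const.mul (hσc y)).mul continuous_const
  have hEq : Set.EqOn (σ x) τ (H : Set Gk) := by
    rw [hH]
    exact eqOn_topologicalClosure_zpowers_of_apply_eq (hσc x) hτc' (by rw [hτ]; exact hagree)
  -- Step 5: Lemma 5.5 over `k_m`
  have hxmem : ∀ (z : Pts) (s : H), σ z s ∈ H.comap augX := fun z s => by
    rw [Subgroup.mem_comap, hσ']; exact s.2
  have hHopen : IsOpen (H : Set Gk) := by
    rw [hH]; exact isOpen_topologicalClosure_zpowers_pow_of_dense hF hm
  have h55m := h55 H hHopen hxmem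
  have hsec : ∀ z : Pts, (augX.subgroupComap H).comp
      (((σ z).comp H.subtype).codRestrict (H.comap augX) (fun s => hxmem z s)) = MonoidHom.id H := by
    intro z
    refine MonoidHom.ext fun s => Subtype.ext ?_
    simp only [MonoidHom.coe_comp, Function.comp_apply, MonoidHom.subgroupComap_apply_coe,
      MonoidHom.codRestrict_apply, Subgroup.coe_subtype, MonoidHom.id_apply]
    exact hσ' z s
  have hcmem : c⁻¹ ∈ H.comap augX := by
    rw [Subgroup.mem_comap, map_inv, hcgeom, inv_one]; exact H.one_mem
  have hxy : x = y := by
    refine h55m hsec x y ⟨⟨c⁻¹, hcmem⟩, fun s => ?_⟩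
    apply Subtype.ext
    simp only [MonoidHom.codRestrict_apply, MonoidHom.coe_comp, Subgroup.coe_subtype, Function.comp_apply,
      Subgroup.coe_mul, Subgroup.coe_inv, inv_inv]
    have := hEq s.2
    rw [hτ] at this
    rw [this]; group
  exact hne (hinj b' b hb' hb (by rw [← hy_def, ← hx_def, hxy]))

/-- **`Π_A`-form of the cross clause.**  With the augmentation `aug : Π → Π_A` of Def 5.3 and an OPEN
continuous residue homomorphism `θ : Π_A → G_k` (`G_K ↠ G_k`) through which the reduction datum is augmented
(`augX ∘ red = θ ∘ aug` on `Π_{𝔊,v}`), the cross clause of Def 5.3 (ii) at `v` holds for `aug` itself.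
[cite: MochizukiSemiAnbd2006, Ex 5.6, p. 67] -/
theorem not_isArithAmple_inf_conj_of_lem55_of_isOpenMap [IsTopologicalGroup Gk] [CompactSpace Gk]
    [IsTopologicalGroup PX] [T2Space PX]
    (D : DecompositionData Gtp V B) (aug : Gtp →* PA) (θ : PA →* Gk) (hθ : IsOpenMap θ) (v : V)
    (red : D.vertGp v →* PX) (augX : PX →* Gk)
    (hcomp : ∀ g : D.vertGp v, augX (red g) = θ (aug g))
    (σ : Pts → (Gk →* PX)) (hσ : ∀ x, augX.comp (σ x) = MonoidHom.id Gk) (hσc : ∀ x, Continuous (σ x))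
    (pt : B → Pts)
    (hpt : ∀ (b : B) (hb : D.abut b = some v) (h : Gtp) (hh : h ∈ D.brGp b),
      red ⟨h, D.brGp_le_vertGp b v hb hh⟩ ∈ (σ (pt b)).range)
    (hinj : ∀ b b' : B, D.abut b = some v → D.abut b' = some v → pt b = pt b' → b = b')
    (F : Gk) (hF : Dense ((Subgroup.zpowers F : Subgroup Gk) : Set Gk))
    (h55 : ∀ H : Subgroup Gk, IsOpen (H : Set Gk) →
      ∀ hx : ∀ (x : Pts) (s : H), σ x s ∈ H.comap augX,
        DecompositionGroupsDetermineStatement (augX.subgroupComap H)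
          (fun x => ((σ x).comp H.subtype).codRestrict (H.comap augX) (fun s => hx x s)))
    {b b' : B} (hb : D.abut b = some v) (hb' : D.abut b' = some v) (hne : b' ≠ b)
    {g : Gtp} (hg : g ∈ D.vertGp v) :
    ¬ IsArithAmple aug (D.brGp b ⊓ conjSubgroup g (D.brGp b')) :=
  not_isArithAmple_of_not_isArithAmple_comp hθ
    (not_isArithAmple_inf_conj_of_lem55 D (θ.comp aug) v red augX (fun g => by simpa using hcomp g)
      σ hσ hσc pt hpt hinj F hF h55 hb hb' hne hg)

end Reduction

/-! ### §4. Assembly: Def 5.3 (ii) from the cross clause and the self clause -/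

/-- **Def 5.3 (ii) for one edge, assembled**: the cross clause (`b' ≠ b`; supplied at the vertices of `e` by
`not_isArithAmple_inf_conj_of_lem55[_of_isOpenMap]`) and the self clause (`b' = b`, `g ∉ Π_{𝔊,b}`; in print the
commensurator description of `Π_{𝔊,b}`, p. 293 top — a separate input, NOT a consequence of Lemma 5.5) give
«`e` is arithmetically estranged». [cite: MochizukiSemiAnbd2006, Def 5.3 (ii), p. 65] -/
theorem isArithEstrangedEdge_of_cross_of_self (D : DecompositionData Gtp V B) (aug : Gtp →* PA) (e : D.E)
    (hcross : ∀ (b : B), D.edgeOf b = e → ∀ (v : V), D.abut b = some v → ∀ g ∈ D.vertGp v,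
      ∀ b' : B, D.abut b' = some v → b' ≠ b → ¬ IsArithAmple aug (D.brGp b ⊓ conjSubgroup g (D.brGp b')))
    (hself : ∀ (b : B), D.edgeOf b = e → ∀ (v : V), D.abut b = some v → ∀ g ∈ D.vertGp v,
      g ∉ D.brGp b → ¬ IsArithAmple aug (D.brGp b ⊓ conjSubgroup g (D.brGp b))) :
    IsArithEstrangedEdge D aug e :=
  fun b hbe v hbv g hg => ⟨fun b' hb' hne => hcross b hbe v hbv g hg b' hb' hne, hself b hbe v hbv g hg⟩

/-- **Def 5.3 (ii) «totally arithmetically estranged», assembled** from the cross clause at every vertex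
(Lemma 5.5, via `not_isArithAmple_inf_conj_of_lem55[_of_isOpenMap]`) and the self clause (named input).
This is the shape of Ex 5.6's sentence «it follows immediately from Lemma 5.5 that `𝔊_i`, `𝔊_i^c` are totally
arithmetically estranged» on abstract data. [cite: MochizukiSemiAnbd2006, Ex 5.6, p. 67] -/
theorem isTotallyArithEstranged_of_cross_of_self (D : DecompositionData Gtp V B) (aug : Gtp →* PA)
    (hcross : ∀ (v : V) (b b' : B), D.abut b = some v → D.abut b' = some v → b' ≠ b →
      ∀ g ∈ D.vertGp v, ¬ IsArithAmple aug (D.brGp b ⊓ conjSubgroup g (D.brGp b')))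
    (hself : ∀ (v : V) (b : B), D.abut b = some v → ∀ g ∈ D.vertGp v,
      g ∉ D.brGp b → ¬ IsArithAmple aug (D.brGp b ⊓ conjSubgroup g (D.brGp b))) :
    IsTotallyArithEstranged D aug :=
  fun e => isArithEstrangedEdge_of_cross_of_self D aug e
    (fun b _ v hbv g hg b' hb' hne => hcross v b b' hbv hb' hne g hg)
    (fun b _ v hbv g hg hgb => hself v b hbv g hg hgb)

end Literature.AnabelianGeometry.SemiGraphs
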